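import Summits.QuantumAdvantage.QuantumAdvantage.Theses.ArithStatLadder
import Literature.NumberTheory.QuadraticFields.ScholzHeckeUnitCriterion
import HarnessLib
import Literature.NumberTheory.QuadraticFields.ScholzHeckeUnitCriterionHolds

/-!
# `UnitCubeCriterion` (route ArithStatLadder, item `stmt-QuantumAdvantage-15003`) — reduction to the named fact

The route item `UnitCubeCriterion` (the Scholz–Hecke unit-cube criterion for the mirror pair
`(ℚ(√3d), ℚ(√−d))`) was INLINED by the planner so that the unproved Literature constant stays out of
the route's used-constants cone; it is *definitionally* the named fact
`Literature.NumberTheory.QuadraticFields.ScholzHecke_unitCubeCriterion`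
(`QuadraticFields/ScholzHeckeUnitCriterion.lean`; its vocabulary `mirrorRadicand`, `IsMirrorFundUnit`,
`unitPow8`, `UnitCubeAtThree` unfolds to the item's `let`-spelling).

This file records that definitional equality as a kernel-checked `Iff.rfl` and the resulting
CONDITIONAL closure `UnitCubeCriterion_of_ScholzHecke`: the day the fact is discharged
(`ScholzHecke_unitCubeCriterion_holds`), the item closes by
`UnitCubeCriterion_of_ScholzHecke ScholzHecke_unitCubeCriterion_holds`.

Nothing here is unconditional progress on the criterion itself (direction (i) = Hecke Satz 119 at `3`
+ Kummer theory away from `3` + Hilbert Satz 94 for the cyclic cubic unramified extension of `ℚ(√−d)`;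
direction (ii) = Kummer generators over `ℚ(√3d, ζ₃)` + class field theory).
-/

set_option linter.dupNamespace false -- D-0017: single-problem summit ⇒ `QuantumAdvantage.QuantumAdvantage` by design

namespace Summit.QuantumAdvantage.QuantumAdvantage.Theorems.ArithStatLadder

/-- The route item `UnitCubeCriterion` is, word for word after unfolding `mirrorRadicand`,
`IsMirrorFundUnit`, `unitPow8` and `UnitCubeAtThree`, the Literature named fact
`ScholzHecke_unitCubeCriterion` (Scholz 1932; Hecke, *Vorlesungen*, Satz 118–119; Washington,
*Introduction to Cyclotomic Fields*, proof of Thm 10.10). Kernel-checked `Iff.rfl`. -/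
theorem UnitCubeCriterion_iff_ScholzHecke :
    Summit.QuantumAdvantage.QuantumAdvantage.Theses.ArithStatLadder.UnitCubeCriterion ↔
      Literature.NumberTheory.QuadraticFields.ScholzHecke_unitCubeCriterion :=
  Iff.rfl

/-- CONDITIONAL closure of item `stmt-QuantumAdvantage-15003`: the named fact
`ScholzHecke_unitCubeCriterion` (undischarged at the time of writing) gives the route item
`UnitCubeCriterion` by definitional unfolding (`UnitCubeCriterion_iff_ScholzHecke`). -/
theorem UnitCubeCriterion_of_ScholzHecke
    (h : Literature.NumberTheory.QuadraticFields.ScholzHecke_unitCubeCriterion) :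
    Summit.QuantumAdvantage.QuantumAdvantage.Theses.ArithStatLadder.UnitCubeCriterion :=
  UnitCubeCriterion_iff_ScholzHecke.mpr h

/-- **Route item `UnitCubeCriterion` (stmt-QuantumAdvantage-15003), PROVED** (appended 2026-08-16 by the lead of
crux stmt-QuantumAdvantage-2427): the named fact is now DISCHARGED in the tree —
`Literature.NumberTheory.QuadraticFields.ScholzHecke_unitCubeCriterion_holds`
(QuadraticFields/ScholzHeckeUnitCriterionHolds.lean, p107486: direction (i) `ScholzHecke.cube_imp_three_dvd`,
Kummer theory + Hecke Satz 119 + Artin reciprocity; direction (ii) `ScholzHecke.three_dvd_imp_cube`, cubic class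
field of `ℚ(√−d)` + Scholz's Kummer generator in the real mirror field + `#Cl₃(D⁺) = 1` + Hecke's necessity at `3`,
first landed summit-side as `Mirror.stub_threeDvdImpCube`, p107075) — so the conditional closure above applies.
[cite: Washington1997, Thm 10.10 (proof)] -/
theorem UnitCubeCriterion_proof :
    Summit.QuantumAdvantage.QuantumAdvantage.Theses.ArithStatLadder.UnitCubeCriterion :=
  UnitCubeCriterion_of_ScholzHecke
    Literature.NumberTheory.QuadraticFields.ScholzHecke_unitCubeCriterion_holds

end Summit.QuantumAdvantage.QuantumAdvantage.Theorems.ArithStatLadder
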